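import Summits.SmoothPoincare4.SmoothPoincare4.Theorems.ConvexBisectionAcyclicBisectionExistsHgapTwistModel
import Summits.SmoothPoincare4.SmoothPoincare4.Theorems.ConvexBisectionAcyclicBisectionExistsSeamTwistSignFrame
import Summits.SmoothPoincare4.SmoothPoincare4.Theorems.ConvexBisectionAcyclicBisectionExistsBeltPageTubeColumn
import HarnessLib

/-!
# Hgap ▸ part B (page twisting of the straightened dual framed knot), brick G2-3 (pointwise):
# the page frame of the pushed belt framing at one point of the belt circle
(wave 6, crux stmt-SmoothPoincare4-10508, line `modp-braid-orbits`, stub `stub_T3_dualPresentation` (T3)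
▸ node `Hgap` ▸ part B `helper_Hgap_twisting`; registered sub-goal `helper_beltFrame_pointwise`)

At a point `q = Γ_u (0)` of the straightened dual circle (flat page of direction `c`) let `T ≠ 0` be its
velocity (a page tangent), `Λ = ∂_m Γ_u (0) : ℝ² → ℝ⁴` the fibre derivative of the pushed belt-tube chart
(`…HgapTwistRadial.lean`, `…HgapTwistFraming.lean`) and `L = M u ≠ 0` the row datum:
`4 ‖dΦ_q‖² ⟪Λ X, n(q)⟫ = ⟪L, X⟫` (`fderiv_beltSlope_radial` + `hasFDerivAt_pageSlope_comp`), `Λ (ℝ²) ⊂ T ∂`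
(`d rho (Λ X) = 0`).  The twisting loop of Hgap's framed knot at this point is `(⟪κΛ e₀, iT⟫, ⟪κΛ e₀, n⟫)`
(`pageTwistingLoop_transport_dualMap`).  This file supplies the two POINTWISE FRAME RELATIONS consumed by
X3's winding step `helper_wind_pointwiseFrame` against the model loop `(σ̂ L₁, L₀)`:

* §1 at a flat page point a boundary tangent with vanishing normal component is a page tangent
  (`dPhi_eq_zero_of_normal_eq_zero`);
* §2 (`beltFrame_pointwise`, registered `helper_beltFrame_pointwise`): `⟪Λ e₀, n⟫ = κ L₀` with `κ > 0`, and
  where `L₀ = 0`: `⟪Λ e₀, iT⟫ = b · (σ̂ L₁)` with `b > 0`, `σ̂ = ±1` the sign of `Q = ⟪Λ N_B, iT⟫`,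
  `N_B := L₁ e₀ − L₀ e₁` the in-page normal of the belt circle; and `Q ≠ 0` as soon as `Λ X ∈ ℝ T ⇒ X = 0`
  (`beltFrame_Q_ne_zero`: `Λ N_B` is a page tangent, hence a complex multiple `z T` of `T` with
  `Q = Im z ‖T‖²`, X3 `eq_mk_mul_of_dPhi_eq_zero`), so that `σ̂` is locally constant along the belt circle.

Everything is proved; no named facts, no `sorry`.  References: J. B. Etnyre, T. Fuller, IMRN 2006, Thm. 1
(proof, p. 8) [EtnyreFuller2006].
-/

noncomputable section

set_option linter.dupNamespace false

open scoped ComplexConjugate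
open Set Function Complex
open Literature.Topology.FourManifolds Literature.Topology.FourManifolds.LefschetzBase

namespace Summit.SmoothPoincare4.SmoothPoincare4.Theorems.AcyclicBisectionExists.ModpBraidOrbits

variable {g : ℕ}

/-! ## §1 Boundary tangents with vanishing normal component are page tangents -/

/-- **At a flat page point (`w q = c/2`), `d rho_q (Y) = 0` and `⟪Y, n(q)⟫ = 0` force `dΦ_q (Y) = 0`**:
`d rho (Y) = Re (c̄ dΦ Y)` and `4‖dΦ‖² ⟪Y, n⟫ = 2 Im (c̄ dΦ Y)`. [folklore] -/
theorem dPhi_eq_zero_of_normal_eq_zero {q Y : EuclideanSpace ℝ (Fin 4)} {c : ℂ} (hc : ‖c‖ = 1)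
    (hw : w g q = c / 2) (hflat : ‖cx q‖ ^ 2 < 4) (hρ : fderiv ℝ (rho g) q Y = 0)
    (hn : inner ℝ Y (horizNormal g q) = 0) :
    dPhiX g q * cx Y + dPhiY q * cy Y = 0 := by
  set Z : ℂ := dPhiX g q * cx Y + dPhiY q * cy Y with hZ
  have hre : (conj c * Z).re = 0 := by
    rw [fderiv_rho_apply_of_flat hflat, hw, map_div₀, Complex.conj_ofNat] at hρ
    have e : (conj c / 2 * Z).re = (conj c * Z).re / 2 := by
      rw [div_mul_eq_mul_div, Complex.div_ofNat_re]
    rw [e] at hρ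
    linarith
  have him : (conj c * Z).im = 0 := by
    have := inner_horizNormal_of_page (g := g) hc hw Y
    rw [hn, mul_zero] at this
    linarith
  have hcZ : conj c * Z = 0 := Complex.ext hre him
  have hc0 : conj c ≠ 0 := by
    rw [map_ne_zero]
    intro h0; rw [h0, norm_zero] at hc; exact zero_ne_one hc
  exact (mul_eq_zero.1 hcZ).resolve_left hc0

/-! ## §2 The page frame of the pushed belt framing at one point -/

/-- **`Q = ⟪Λ N_B, iT⟫ ≠ 0`**: the in-page normal `N_B = L₁ e₀ − L₀ e₁` of the belt circle is carried by `Λ`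
to a page tangent (`⟪Λ N_B, n⟫ ∝ ⟪L, N_B⟫ = 0`), i.e. to a complex multiple `z T` of the velocity, and
`Im z ≠ 0` because `Λ` hits the real line `ℝ T` only at `0`. [cite: EtnyreFuller2006, Thm. 1 (proof, p. 8)] -/
theorem beltFrame_Q_ne_zero {q T : EuclideanSpace ℝ (Fin 4)} {Λ : EuclideanSpace ℝ (Fin 2) →L[ℝ] EuclideanSpace ℝ (Fin 4)}
    {L : EuclideanSpace ℝ (Fin 2)} {c : ℂ} (hc : ‖c‖ = 1) (hw : w g q = c / 2) (hflat : ‖cx q‖ ^ 2 < 4)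
    (hT0 : T ≠ 0) (hT : dPhiX g q * cx T + dPhiY q * cy T = 0)
    (hρ : ∀ X, fderiv ℝ (rho g) q (Λ X) = 0)
    (hL : ∀ X, 4 * (‖dPhiX g q‖ ^ 2 + ‖dPhiY q‖ ^ 2) * inner ℝ (Λ X) (horizNormal g q) = inner ℝ L X)
    (hL0 : L ≠ 0) (hinj : ∀ (X : EuclideanSpace ℝ (Fin 2)) (a : ℝ), Λ X = a • T → X = 0) :
    inner ℝ (Λ (L 1 • planeE0 - L 0 • planeE1)) (cplxJ T) ≠ 0 := by
  have hq : q ≠ 0 := ne_zero_of_w_eq_half hc hw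
  have hN : 0 < 4 * (‖dPhiX g q‖ ^ 2 + ‖dPhiY q‖ ^ 2) := by
    have := normSq_dPhi_ne_zero (g := g) hq
    positivity
  set NB : EuclideanSpace ℝ (Fin 2) := L 1 • planeE0 - L 0 • planeE1 with hNB
  -- `Λ N_B` is a page tangent
  have hNn : inner ℝ (Λ NB) (horizNormal g q) = 0 := by
    have h := hL NB
    have h0 : inner ℝ L NB = 0 := by
      rw [hNB, inner_sub_right, real_inner_smul_right, real_inner_smul_right]
      simp [EuclideanSpace.inner_single_right, planeE0, planeE1]
      ring
    rw [h0] at h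
    exact (mul_eq_zero.1 h).resolve_left hN.ne'
  have hNL : dPhiX g q * cx (Λ NB) + dPhiY q * cy (Λ NB) = 0 :=
    dPhi_eq_zero_of_normal_eq_zero hc hw hflat (hρ NB) hNn
  -- so `Λ N_B = z · T`
  set z : ℂ := (cx (Λ NB) * conj (cx T) + cy (Λ NB) * conj (cy T)) / ((‖T‖ ^ 2 : ℝ) : ℂ) with hz
  have hrep : Λ NB = LefschetzBase.mk (z * cx T) (z * cy T) := eq_mk_mul_of_dPhi_eq_zero hq hT0 hT hNL
  rw [hrep, inner_mk_mul_cplxJ]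
  intro h0
  have hn : (0 : ℝ) < ‖T‖ ^ 2 := by positivity
  have hzim : z.im = 0 := by
    rcases mul_eq_zero.1 h0 with h | h
    · exact h
    · exact absurd h hn.ne'
  -- then `Λ N_B = (Re z) • T`, so `N_B = 0`, so `L = 0`
  have hreal : Λ NB = z.re • T := by
    rw [hrep, mk_mul_eq_add_smul, hzim, zero_smul, add_zero]
  have hNB0 : NB = 0 := hinj NB z.re hreal
  apply hL0
  have h0 : L 0 = 0 := by
    have := congrArg (fun v : EuclideanSpace ℝ (Fin 2) => v 1) hNB0
    simpa [hNB, planeE0, planeE1] using this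
  have h1 : L 1 = 0 := by
    have := congrArg (fun v : EuclideanSpace ℝ (Fin 2) => v 0) hNB0
    simpa [hNB, planeE0, planeE1] using this
  ext i
  fin_cases i
  · exact h0
  · exact h1

/-- **The page frame of the pushed belt framing at one point** (brick G2-3, pointwise).  With the data
above and `σ̂ = ±1` the sign of `Q = ⟪Λ N_B, iT⟫`:
(i) `⟪Λ e₀, n⟫ = κ · L₀` with `κ = 1/(4‖dΦ‖²) > 0`;
(ii) if `L₀ = 0` then `⟪Λ e₀, iT⟫ = b · (σ̂ L₁)` with `b > 0` (`N_B = L₁ e₀`, `b = σ̂ Q / L₁²`).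
These are the hypotheses `him`, `hre` of `helper_wind_pointwiseFrame` for the twisting loop
`(⟪Λ e₀, iT⟫, ⟪Λ e₀, n⟫)` against the model loop `(σ̂ L₁, L₀)`. [cite: EtnyreFuller2006, Thm. 1 (proof, p. 8)] -/
theorem beltFrame_pointwise {q T : EuclideanSpace ℝ (Fin 4)} {Λ : EuclideanSpace ℝ (Fin 2) →L[ℝ] EuclideanSpace ℝ (Fin 4)}
    {L : EuclideanSpace ℝ (Fin 2)} {c : ℂ} {σ : ℤ} (hc : ‖c‖ = 1) (hw : w g q = c / 2)
    (hL : ∀ X, 4 * (‖dPhiX g q‖ ^ 2 + ‖dPhiY q‖ ^ 2) * inner ℝ (Λ X) (horizNormal g q) = inner ℝ L X)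
    (hσ : σ = 1 ∨ σ = -1)
    (hQ : 0 < (σ : ℝ) * inner ℝ (Λ (L 1 • planeE0 - L 0 • planeE1)) (cplxJ T)) :
    (∃ κ : ℝ, 0 < κ ∧ inner ℝ (Λ planeE0) (horizNormal g q) = κ * L 0) ∧
    (L 0 = 0 → ∃ b : ℝ, 0 < (1 : ℝ) * b ∧ inner ℝ (Λ planeE0) (cplxJ T) = b * ((σ : ℝ) * L 1)) := by
  have hq : q ≠ 0 := ne_zero_of_w_eq_half hc hw
  have hN : 0 < 4 * (‖dPhiX g q‖ ^ 2 + ‖dPhiY q‖ ^ 2) := by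
    have := normSq_dPhi_ne_zero (g := g) hq
    positivity
  have hσ2 : (σ : ℝ) * σ = 1 := by rcases hσ with h | h <;> simp [h]
  constructor
  · refine ⟨(4 * (‖dPhiX g q‖ ^ 2 + ‖dPhiY q‖ ^ 2))⁻¹, inv_pos.2 hN, ?_⟩
    have h := hL planeE0
    have e : inner ℝ L planeE0 = L 0 := by simp [EuclideanSpace.inner_single_right, planeE0]
    rw [e] at h
    rw [← h, ← mul_assoc, inv_mul_cancel₀ hN.ne', one_mul]
  · intro h0
    have hL1 : L 1 ≠ 0 := by
      intro h1
      have : L 1 • planeE0 - L 0 • planeE1 = 0 := by rw [h0, h1, zero_smul, zero_smul, sub_zero]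
      rw [this, map_zero, inner_zero_left, mul_zero] at hQ
      exact lt_irrefl _ hQ
    have hQe : inner ℝ (Λ (L 1 • planeE0 - L 0 • planeE1)) (cplxJ T) = L 1 * inner ℝ (Λ planeE0) (cplxJ T) := by
      rw [h0, zero_smul, sub_zero, map_smul, real_inner_smul_left]
    refine ⟨(σ : ℝ) * inner ℝ (Λ (L 1 • planeE0 - L 0 • planeE1)) (cplxJ T) / (L 1) ^ 2, ?_, ?_⟩
    · rw [one_mul]
      exact div_pos hQ (by positivity)
    · rw [hQe]
      have e : (σ : ℝ) * (L 1 * inner ℝ (Λ planeE0) (cplxJ T)) / L 1 ^ 2 * ((σ : ℝ) * L 1) =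
          ((σ : ℝ) * σ) * inner ℝ (Λ planeE0) (cplxJ T) * (L 1 ^ 2 / L 1 ^ 2) := by ring
      rw [e, hσ2, div_self (pow_ne_zero 2 hL1), one_mul, mul_one]

/-- **Sub-goal `helper_beltFrame_pointwise` of stub `stub_T3_dualPresentation`** (T3 ▸ node `Hgap` ▸ part B
`helper_Hgap_twisting`, brick G2-3 pointwise; wave 6, lead c5): the two pointwise frame relations of the pushed
belt framing against the model loop `(σ̂ L₁, L₀)`. [cite: EtnyreFuller2006, Thm. 1 (proof, p. 8)] -/
theorem helper_beltFrame_pointwise : ∀ (g : ℕ) (q T : EuclideanSpace ℝ (Fin 4)) (Λ : EuclideanSpace ℝ (Fin 2) →L[ℝ] EuclideanSpace ℝ (Fin 4)) (L : EuclideanSpace ℝ (Fin 2)) (c : ℂ) (σ : ℤ), ‖c‖ = 1 → Literature.Topology.FourManifolds.LefschetzBase.w g q = c / 2 → (∀ X, 4 * (‖Literature.Topology.FourManifolds.LefschetzBase.dPhiX g q‖ ^ 2 + ‖Literature.Topology.FourManifolds.LefschetzBase.dPhiY q‖ ^ 2) * inner ℝ (Λ X) (Literature.Topology.FourManifolds.LefschetzBase.horizNormal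 g q) = inner ℝ L X) → (σ = 1 ∨ σ = -1) → 0 < (σ : ℝ) * inner ℝ (Λ (L 1 • Literature.Topology.FourManifolds.planeE0 - L 0 • Literature.Topology.FourManifolds.planeE1)) (Literature.Topology.FourManifolds.LefschetzBase.cplxJ T) → (∃ κ : ℝ, 0 < κ ∧ inner ℝ (Λ Literature.Topology.FourManifolds.planeE0) (Literature.Topology.FourManifolds.LefschetzBase.horizNormal g q) = κ * L 0) ∧ (L 0 = 0 → ∃ b : ℝ, 0 < (1 : ℝ) * b ∧ inner ℝ (Λ Literature.Topology.FourManifolds.planeE0) (Literature.Topology.FourManifolds.LefschetzBase.cplxJ T) = b * ((σ : ℝ) * L 1)) :=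
  fun _ _ _ _ _ _ _ hc hw hL hσ hQ => beltFrame_pointwise hc hw hL hσ hQ

end Summit.SmoothPoincare4.SmoothPoincare4.Theorems.AcyclicBisectionExists.ModpBraidOrbits

end
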